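import Literature.AlgebraicGeometry.HodgeTheory.FermatConeSpanOfIncidenceDatum
import HarnessLib

/-!
# The cone-span leaf (III-l) from COORDINATES: the incidence datum follows from "the base section is the sub-Fermat embedding" and "off the base, `x₁ = ε x₀ ≠ 0`"; `φ^*(φ_* 1) ≠ 0` follows from `φ_* 1 ≠ 0`

Family `hodge`, layer `Literature/AlgebraicGeometry/HodgeTheory`. PROOF FILE (theorems only; no
definition, no named fact). Sequel of `FermatConeSpanOfIncidenceDatum` (N. Aoki, J. Math. Soc. Japan 39
(1987), Thm. 1-4 (i), `r = 0`; Z. Ran, Compositio Math. 42 (1980), §4 p. 138 "if `p′ ∈ V′` and `p″ ∈ V″`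
then the line `p′p″` … is entirely contained in `V`", Prop. 1.14; T. Shioda, Math. Ann. 245 (1979), Thm. I).
The incidence datum (inc') + (h1) asked there of a span `S = X²ˢₘ ←π— E —φ→ X = X^{2(0+s+1)}ₘ` with base
section `σ` is here derived from three statements that are IMMEDIATE for the printed cone
`C_ε = X ∩ {x₁ = ε x₀}` over `S = X ∩ {x₀ = x₁ = 0}` blown up at its vertex:

* (base) `σ ≫ φ = ι_S`, the sub-Fermat embedding `fermatEmb (embSecond 0 s)` (`[z] ↦ [0 : 0 : z]`);
* (cone) for every complex point `P` of `E` off the section, the point `φ(P) = [x]` has `x₀ ≠ 0` and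
  `x₁ = ε x₀` (it lies on the cone, off the base);
* (h1') `φ_* 1 ≠ 0` in `H²(X(ℂ); ℂ)` (e.g. `φ` an immersion at one point,
  `complexGysin_one_ne_zero_of_stalkMap_surjective`).

Indeed a diagonal symmetry `g_c` with `c₀ ≠ c₁` changes the ratio `x₁/x₀` off the base and fixes the
locus `x₀ = 0`, so `g_c(φ P) = φ Q` forces both points onto the base, where `φ = ι_S` is injective and
`g_c ∘ ι_S = ι_S ∘ g_{c|S}` (`diagonalMap_comp_coordEmbMap`) — this is (inc'); and `φ^*(φ_* 1) = 0` would
give `(φ_* 1)² = φ_*(φ^* φ_* 1 ⌣ 1) = 0` (projection formula), whereas `φ_* 1 = ι^* η`, `η ≠ 0` in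
`H²(ℙ^{2s+3})` (Lefschetz below the middle degree) has `(φ_* 1)² = ι^*(η ⌣ η) ≠ 0` (`η ⌣ η ≠ 0` on
projective space, `ι^*` injective in degree `4 ≤ dim X`, `map_ne_zero_of_le`) — this is (h1).

* `map_complexGysin_one_ne_zero_of_ne_zero` — `φ_* 1 ≠ 0 ⟹ φ^*(φ_* 1) ≠ 0` for `φ : E → X^{2(0+s+1)}ₘ`,
  `dim E = 2s + 1`, `s ≥ 1`;
* `coneIncidence_of_coordinates` — (base) + (cone) ⟹ (inc');
* `coneSpan_represents_of_coneCoordinates`, `Shioda1979_coneSpan_represents_left_of_coneCoordinates` — the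
  conclusion of (III-l) for `(m, s)`, resp. the leaf itself, from spans with (base), (cone), (h1').

## References

* [Aoki1987] N. Aoki, Some new algebraic cycles on Fermat varieties, J. Math. Soc. Japan 39 (1987),
  Thm. 1-4 (i) p. 388, p. 386.
* [Ran1980] Z. Ran, Cycles on Fermat hypersurfaces, Compositio Math. 42 (1980), §4 p. 138, §1 Prop. 1.14.
* [Shioda1979HodgeFermat] T. Shioda, The Hodge conjecture for Fermat varieties, Math. Ann. 245 (1979), Thm. I.
* [daSilva2021HodgeFermat] G. da Silva Jr., arXiv:2101.04739, Thm. 2.2 (b).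
* [VoisinHodgeII2003] C. Voisin, Hodge Theory and Complex Algebraic Geometry II, §1.2.3 Cor. 1.24–1.25.
* [FultonYoungTableaux1997] W. Fulton, Young Tableaux, App. B §B.1 (6) (projection formula).
-/

noncomputable section

open CategoryTheory AlgebraicGeometry Finset
open Literature.AlgebraicGeometry.Motives Literature.AlgebraicTopology.SingularHomology

namespace Literature.AlgebraicGeometry.HodgeTheory

open FermatCharacter (append embFirst embSecond)

variable {m s : ℕ}

/-- **`φ_* 1 ≠ 0 ⟹ φ^*(φ_* 1) ≠ 0`** for `φ : E ⟶ X = X^{2(0+s+1)}ₘ` from a smooth projective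
`(2s+1)`-fold, `s ≥ 1`, `m ≥ 1`: `φ_* 1 = ι^* η` with `η ≠ 0` in `H²(ℙ^{2s+3}(ℂ); ℂ)` (Lefschetz,
`surjective_map_hypersurfaceι_of_lt`); if `φ^*(φ_* 1) = 0` then
`ι^*(η ⌣ η) = (φ_* 1) ⌣ (φ_* 1) = φ_*(φ^*(φ_* 1) ⌣ 1) = 0` (projection formula `complexGysin_cup`),
contradicting `η ⌣ η ≠ 0` (`cupProduct_ne_zero_complexBetti_projectiveSpace`) and the injectivity of
`ι^*` in degree `4 ≤ 2s + 2` (`map_ne_zero_of_le`). [cite: VoisinHodgeII2003, §1.2.3 Cor. 1.24–1.25]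
[cite: FultonYoungTableaux1997, Appendix B §B.1 (6)] -/
theorem map_complexGysin_one_ne_zero_of_ne_zero [NeZero m] (hs : 1 ≤ s)
    {E : SchemeOver ℂ} (hE : IsSmoothProjective (2 * s + 1) E)
    (hX : IsSmoothProjective (2 * (0 + s + 1)) (fermatHypersurface (2 * (0 + s + 1)) m))
    (φ : E ⟶ fermatHypersurface (2 * (0 + s + 1)) m)
    (h1 : complexGysin complexOrientationFamily hE hX φ
      (show 0 + 2 * (2 * (0 + s + 1)) = 2 + 2 * (2 * s + 1) by omega)
      (singularCohomology.one ℂ (ComplexPoints E)) ≠ 0) :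
    complexBetti.map φ 2 (complexGysin complexOrientationFamily hE hX φ
      (show 0 + 2 * (2 * (0 + s + 1)) = 2 + 2 * (2 * s + 1) by omega)
      (singularCohomology.one ℂ (ComplexPoints E))) ≠ 0 := by
  have hm : 1 ≤ m := NeZero.one_le
  have hμ : complexOrientationFamily.HasPoincareDuality := hasPoincareDuality_complexOrientationFamily
  set F := fermatPolynomial ℂ (2 * (0 + s + 1)) m with hF
  have hirr : Irreducible F := irreducible_fermatPolynomial_of_isAlgClosed (by omega) hm
  have hsurj2 : Function.Surjective (complexBetti.map (SmoothHypersurface.hypersurfaceι F) 2) :=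
    surjective_map_hypersurfaceι_of_lt (isSmoothHypersurface_fermatHypersurface (by omega) hm)
      (isHomogeneous_fermatPolynomial _ m) hirr (by omega)
  set y := complexGysin complexOrientationFamily hE hX φ
      (show 0 + 2 * (2 * (0 + s + 1)) = 2 + 2 * (2 * s + 1) by omega)
      (singularCohomology.one ℂ (ComplexPoints E)) with hy
  obtain ⟨η, hη⟩ := hsurj2 y
  have hη0 : η ≠ 0 := by
    rintro rfl
    exact h1 (by rw [← hη, map_zero])
  intro h0
  -- `(φ_* 1) ⌣ (φ_* 1) = φ_*(φ^*(φ_* 1) ⌣ 1) = 0`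
  have hproj := complexGysin_cup hμ hE hX φ (p := 2) (q := 0) (a := 2) (b := 4) (q' := 2) rfl
    (show 2 + 2 * (2 * (0 + s + 1)) = 4 + 2 * (2 * s + 1) by omega)
    (show 0 + 2 * (2 * (0 + s + 1)) = 2 + 2 * (2 * s + 1) by omega) rfl y
    (singularCohomology.one ℂ (ComplexPoints E))
  rw [h0, LinearMap.map_zero₂, map_zero] at hproj
  -- `… = ι^*(η ⌣ η) ≠ 0`
  haveI : IsReduced (fermatHypersurface (2 * (0 + s + 1)) m).left := by
    haveI := IsSmoothProjective.isIntegral_holds hX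
    infer_instance
  have hne : complexBetti.map (SmoothHypersurface.hypersurfaceι F) (2 * 2)
      (cupProduct (show 2 * 1 + 2 * 1 = 2 * 2 by norm_num) η η) ≠ 0 :=
    map_ne_zero_of_le hX (isHomogeneous_fermatPolynomial _ m) hirr inferInstance
      (SmoothHypersurface.hypersurfaceι F) (SmoothHypersurface.range_hypersurfaceι F) (p := 2) (by omega)
      (cupProduct_ne_zero_complexBetti_projectiveSpace _ (p := 1) (q := 1) (by norm_num) (by omega) hη0 hη0)
  apply hne
  change singularCohomology.map ℂ ℂ (AlgPoints.mapContinuous (L := ℂ) (SmoothHypersurface.hypersurfaceι F)) (2 * 2)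
    (cupProduct _ η η) = 0
  rw [cupProduct_map]
  change cupProduct _ (complexBetti.map (SmoothHypersurface.hypersurfaceι F) 2 η)
    (complexBetti.map (SmoothHypersurface.hypersurfaceι F) 2 η) = 0
  rw [hη]
  exact hproj.symm

/-- **(base) + (cone) ⟹ the incidence property (inc').** Let `σ` be a section-like map
`S = X²ˢₘ ⟶ E` with `σ ≫ φ = ι_S` (the sub-Fermat embedding along `embSecond 0 s`, `[z] ↦ [0 : 0 : z]`),
and suppose every complex point `P` of `E` off the image of `σ` maps to a point `φ(P) = [x]` with
`x₀ ≠ 0`, `x₁ = ε x₀`. Then for every diagonal symmetry `g_c` with `c₀ ≠ c₁`: `g_c(φ P) = φ Q` forces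
`P = σ R`, `Q = σ(g_{c|S} R)` — the moved cone `{x₁ = ε (c₁/c₀) x₀}` meets the cone `{x₁ = ε x₀}` only in
`{x₀ = x₁ = 0} = ι_S(S)`, pointwise fixed by the vertex move up to `g_{c|S}`
(`diagonalMap_comp_coordEmbMap`, `fermatEmbMap_injective`). [cite: Ran1980, §4 p. 138]
[cite: Aoki1987, Thm. 1-4 (i) p. 388] -/
theorem coneIncidence_of_coordinates [NeZero m]
    {E : SchemeOver ℂ} (σ : fermatHypersurface (2 * s) m ⟶ E)
    (φ : E ⟶ fermatHypersurface (2 * (0 + s + 1)) m)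
    (hσφ : σ ≫ φ = fermatEmb (embSecond 0 s) NeZero.one_le) {ε : ℂ} (hε : ε ≠ 0)
    (hcone : ∀ P : ComplexPoints E, P ∉ Set.range (AlgPoints.map σ) →
      (hypersurfacePoint (SmoothHypersurface.hypersurfaceι (fermatPolynomial ℂ (2 * (0 + s + 1)) m))
          (AlgPoints.map φ P)).rep (embFirst 0 s 0) ≠ 0 ∧
      (hypersurfacePoint (SmoothHypersurface.hypersurfaceι (fermatPolynomial ℂ (2 * (0 + s + 1)) m))
          (AlgPoints.map φ P)).rep (embFirst 0 s 1) =
        ε * (hypersurfacePoint (SmoothHypersurface.hypersurfaceι (fermatPolynomial ℂ (2 * (0 + s + 1)) m))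
          (AlgPoints.map φ P)).rep (embFirst 0 s 0))
    (c : fermatGroup (2 * (0 + s + 1)) m)
    (hc : (c : Fin (2 * (0 + s + 1) + 2) → ℂˣ) (embFirst 0 s 0) ≠
      (c : Fin (2 * (0 + s + 1) + 2) → ℂˣ) (embFirst 0 s 1))
    (P Q : ComplexPoints E)
    (h : AlgPoints.map (φ ≫ diagonalAut (fermatPolynomial ℂ (2 * (0 + s + 1)) m)
      (fermatGroup_le_diagonalStabilizer m c.2)) P = AlgPoints.map φ Q) :
    ∃ R : ComplexPoints (fermatHypersurface (2 * s) m), AlgPoints.map σ R = P ∧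
      AlgPoints.map (diagonalAut (fermatPolynomial ℂ (2 * s) m)
        (fermatGroup_le_diagonalStabilizer m (comp_embSecond_mem_fermatGroup c)) ≫ σ) R = Q := by
  have hm : 1 ≤ m := NeZero.one_le
  have hc' := fermatGroup_le_diagonalStabilizer m c.2
  -- coordinates of `φ Q = g_c(φ P)`
  rw [AlgPoints.map_comp_apply] at h
  obtain ⟨t, ht⟩ := exists_rep_hypersurfacePoint_diagonalMap (fermatPolynomial ℂ (2 * (0 + s + 1)) m) hc' (AlgPoints.map φ P)
  rw [diagonalMap_apply, h] at ht
  have hQ0 : (hypersurfacePoint (SmoothHypersurface.hypersurfaceι (fermatPolynomial ℂ (2 * (0 + s + 1)) m)) (AlgPoints.map φ Q)).rep (embFirst 0 s 0) =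
      t * (((c : Fin (2 * (0 + s + 1) + 2) → ℂˣ) (embFirst 0 s 0) : ℂ) *
        (hypersurfacePoint (SmoothHypersurface.hypersurfaceι (fermatPolynomial ℂ (2 * (0 + s + 1)) m)) (AlgPoints.map φ P)).rep (embFirst 0 s 0)) := by
    have := congrFun ht (embFirst 0 s 0)
    rwa [Pi.smul_apply, smul_eq_mul, smul_apply_eq_mul] at this
  have hQ1 : (hypersurfacePoint (SmoothHypersurface.hypersurfaceι (fermatPolynomial ℂ (2 * (0 + s + 1)) m)) (AlgPoints.map φ Q)).rep (embFirst 0 s 1) =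
      t * (((c : Fin (2 * (0 + s + 1) + 2) → ℂˣ) (embFirst 0 s 1) : ℂ) *
        (hypersurfacePoint (SmoothHypersurface.hypersurfaceι (fermatPolynomial ℂ (2 * (0 + s + 1)) m)) (AlgPoints.map φ P)).rep (embFirst 0 s 1)) := by
    have := congrFun ht (embFirst 0 s 1)
    rwa [Pi.smul_apply, smul_eq_mul, smul_apply_eq_mul] at this
  have ht0 : t ≠ 0 := by
    rintro rfl
    rw [zero_smul] at ht
    exact Projectivization.rep_nonzero _ ht
  -- points of the base have `x₀ = 0`
  have hφσ : ∀ R : ComplexPoints (fermatHypersurface (2 * s) m),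
      AlgPoints.map φ (AlgPoints.map σ R) = fermatEmbMap (embSecond 0 s) hm R := by
    intro R
    rw [← AlgPoints.map_comp_apply, hσφ]
    rfl
  have hbase : ∀ R : ComplexPoints (fermatHypersurface (2 * s) m),
      (hypersurfacePoint (SmoothHypersurface.hypersurfaceι (fermatPolynomial ℂ (2 * (0 + s + 1)) m)) (AlgPoints.map φ (AlgPoints.map σ R))).rep (embFirst 0 s 0) = 0 := by
    intro R
    rw [hφσ R, fermatEmbMap_eq]
    obtain ⟨u, hu⟩ := exists_rep_hypersurfacePoint_coordEmbMap (fermatPolynomial ℂ (2 * (0 + s + 1)) m) (fermatPolynomial ℂ (2 * s) m)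
      (aeval_embSubst_fermatPolynomial (embSecond 0 s) hm) R
    rw [hu, Pi.smul_apply, smul_eq_mul, extendVec_apply_of_not_mem_range, mul_zero]
    rintro ⟨k, hk⟩
    exact FermatCharacter.embFirst_ne_embSecond (r := 0) (s := s) 0 k hk.symm
  -- Step 1: `Q` lies on the base
  have hQ : Q ∈ Set.range (AlgPoints.map σ) := by
    by_contra hQn
    obtain ⟨hQz0, hQz1⟩ := hcone Q hQn
    by_cases hPn : P ∈ Set.range (AlgPoints.map σ)
    · obtain ⟨R, rfl⟩ := hPn
      apply hQz0
      rw [hQ0, hbase R, mul_zero, mul_zero]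
    · obtain ⟨hPz0, hPz1⟩ := hcone P hPn
      rw [hQ0, hQ1, hPz1] at hQz1
      apply hc
      apply Units.val_injective
      -- `t c₁ ε z = ε t c₀ z` with `t, ε, z ≠ 0`
      have hprod : t * (ε * (hypersurfacePoint (SmoothHypersurface.hypersurfaceι (fermatPolynomial ℂ (2 * (0 + s + 1)) m)) (AlgPoints.map φ P)).rep (embFirst 0 s 0)) ≠ 0 :=
        mul_ne_zero ht0 (mul_ne_zero hε hPz0)
      have : (((c : Fin (2 * (0 + s + 1) + 2) → ℂˣ) (embFirst 0 s 1) : ℂ) - ((c : Fin (2 * (0 + s + 1) + 2) → ℂˣ) (embFirst 0 s 0) : ℂ)) *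
          (t * (ε * (hypersurfacePoint (SmoothHypersurface.hypersurfaceι (fermatPolynomial ℂ (2 * (0 + s + 1)) m)) (AlgPoints.map φ P)).rep (embFirst 0 s 0))) = 0 := by
        linear_combination hQz1
      exact (sub_eq_zero.mp ((mul_eq_zero.mp this).resolve_right hprod)).symm
  obtain ⟨R', rfl⟩ := hQ
  -- Step 2: `P` lies on the base
  have hP : P ∈ Set.range (AlgPoints.map σ) := by
    by_contra hPn
    obtain ⟨hPz0, -⟩ := hcone P hPn
    have h0 := hbase R'
    rw [hQ0] at h0
    exact mul_ne_zero ht0 (mul_ne_zero (Units.ne_zero _) hPz0) h0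
  obtain ⟨R, rfl⟩ := hP
  refine ⟨R, rfl, ?_⟩
  -- Step 3: `g_c(ι R) = ι R'` gives `ι(g_{c|S} R) = ι R'`, hence `g_{c|S} R = R'`
  rw [AlgPoints.map_comp_apply]
  congr 1
  apply fermatEmbMap_injective (embSecond 0 s) hm
  have hcomm := diagonalMap_comp_coordEmbMap (fermatPolynomial ℂ (2 * (0 + s + 1)) m) (fermatPolynomial ℂ (2 * s) m) (aeval_embSubst_fermatPolynomial (embSecond 0 s) hm) hc'
    (fermatGroup_le_diagonalStabilizer m (comp_embSecond_mem_fermatGroup c))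
  have h' := congrArg (fun f ↦ f R) (congrArg DFunLike.coe hcomm)
  simp only [ContinuousMap.coe_comp, Function.comp_apply] at h'
  rw [hφσ R, hφσ R', ← diagonalMap_apply] at h
  rw [fermatEmbMap_eq, ← diagonalMap_apply, ← h', ← fermatEmbMap_eq, h]

/-- **The conclusion of the cone-span leaf (III-l) for `(m, s)` from coordinates.** Let `m, s ≥ 1`
and `X²ˢₘ ←π— E —φ→ X^{2(0+s+1)}ₘ` be a span of smooth projective varieties (`dim E = 2s+1`, `π` flat)
with a closed-immersion section `σ` such that (base) `σ ≫ φ = ι_S` is the sub-Fermat embedding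
`[z] ↦ [0 : 0 : z]`, (cone) every point of `E` off `σ` maps to `[x]` with `x₀ ≠ 0`, `x₁ = ε x₀` for a
fixed `ε ≠ 0`, and (h1') `φ_* 1 ≠ 0`. Then for all Hodge `α` of `X⁰ₘ` and `β ∈ 𝔅²ˢₘ` some `w ∈ V(β)`
has `π_{α∗β}(φ_*(π^* w)) ≠ 0`. [cite: Aoki1987, Thm. 1-4 (i) p. 388 and p. 386] [cite: Ran1980, §4 p. 138]
[cite: Shioda1979HodgeFermat, Thm. I] [cite: VoisinHodgeII2003, §1.2.3 Cor. 1.24–1.25] -/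
theorem coneSpan_represents_of_coneCoordinates [NeZero m] (hs : 1 ≤ s)
    {E : SchemeOver ℂ} (hE : IsSmoothProjective (2 * s + 1) E)
    (hX : IsSmoothProjective (2 * (0 + s + 1)) (fermatHypersurface (2 * (0 + s + 1)) m))
    (π : E ⟶ fermatHypersurface (2 * s) m)
    (σ : fermatHypersurface (2 * s) m ⟶ E) (hσπ : σ ≫ π = 𝟙 _) [IsClosedImmersion σ.left]
    (φ : E ⟶ fermatHypersurface (2 * (0 + s + 1)) m)
    (hσφ : σ ≫ φ = fermatEmb (embSecond 0 s) NeZero.one_le) {ε : ℂ} (hε : ε ≠ 0)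
    (hcone : ∀ P : ComplexPoints E, P ∉ Set.range (AlgPoints.map σ) →
      (hypersurfacePoint (SmoothHypersurface.hypersurfaceι (fermatPolynomial ℂ (2 * (0 + s + 1)) m))
          (AlgPoints.map φ P)).rep (embFirst 0 s 0) ≠ 0 ∧
      (hypersurfacePoint (SmoothHypersurface.hypersurfaceι (fermatPolynomial ℂ (2 * (0 + s + 1)) m))
          (AlgPoints.map φ P)).rep (embFirst 0 s 1) =
        ε * (hypersurfacePoint (SmoothHypersurface.hypersurfaceι (fermatPolynomial ℂ (2 * (0 + s + 1)) m))
          (AlgPoints.map φ P)).rep (embFirst 0 s 0))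
    (h1 : complexGysin complexOrientationFamily hE hX φ
      (show 0 + 2 * (2 * (0 + s + 1)) = 2 + 2 * (2 * s + 1) by omega)
      (singularCohomology.one ℂ (ComplexPoints E)) ≠ 0)
    {α : Fin (2 * 0 + 2) → ZMod m} {β : Fin (2 * s + 2) → ZMod m}
    (hα : FermatCharacter.IsHodge α) (hβ : FermatCharacter.IsHodge β) :
    ∃ w ∈ fermatEigenspace m β (2 * s),
      fermatProjector m (append α β) (2 * (0 + s + 1))
        (complexGysin complexOrientationFamily hE hX φ
          (show 2 * s + 2 * (2 * (0 + s + 1)) = 2 * (0 + s + 1) + 2 * (2 * s + 1) by omega)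
          (complexBetti.map π (2 * s) w)) ≠ 0 :=
  coneSpan_represents_of_incidenceDatum hs hE hX π σ hσπ φ
    (fun c hc P Q h ↦ coneIncidence_of_coordinates σ φ hσφ hε hcone c hc P Q h)
    (map_complexGysin_one_ne_zero_of_ne_zero hs hE hX φ h1) hα hβ

/-- **The leaf (III-l) `Shioda1979_coneSpan_represents_left` from cone coordinates for all `m, s ≥ 1`.**
Residual obligation on this road: for each `m, s ≥ 1`, a smooth projective `(2s+1)`-fold `E`, a flat
`π : E ⟶ X²ˢₘ` with a closed-immersion section `σ`, and `φ : E ⟶ X^{2(0+s+1)}ₘ` with (base) `σ ≫ φ = ι_S`,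
(cone) off `σ` the image has `x₀ ≠ 0`, `x₁ = ε x₀` (`ε ≠ 0` fixed), (h1') `φ_* 1 ≠ 0` — in print the
cone `X ∩ {x₁ = ε x₀}`, `εᵐ = -1`, blown up at its vertex (`E = ℙ_S(O ⊕ O(1))`).
[cite: Aoki1987, Thm. 1-4 (i) p. 388 and p. 386] [cite: Ran1980, §4 p. 138] [cite: daSilva2021HodgeFermat, Thm. 2.2 (b)] -/
theorem Shioda1979_coneSpan_represents_left_of_coneCoordinates
    (hdata : ∀ (m s : ℕ) [NeZero m], 1 ≤ s →
      ∃ (E : SchemeOver ℂ) (hE : IsSmoothProjective (2 * s + 1) E)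
        (π : E ⟶ fermatHypersurface (2 * s) m) (_ : Flat π.left)
        (σ : fermatHypersurface (2 * s) m ⟶ E) (_ : σ ≫ π = 𝟙 _) (_ : IsClosedImmersion σ.left)
        (φ : E ⟶ fermatHypersurface (2 * (0 + s + 1)) m) (_ : σ ≫ φ = fermatEmb (embSecond 0 s) NeZero.one_le)
        (ε : ℂ) (_ : ε ≠ 0),
        (∀ P : ComplexPoints E, P ∉ Set.range (AlgPoints.map σ) →
          (hypersurfacePoint (SmoothHypersurface.hypersurfaceι (fermatPolynomial ℂ (2 * (0 + s + 1)) m))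
              (AlgPoints.map φ P)).rep (embFirst 0 s 0) ≠ 0 ∧
          (hypersurfacePoint (SmoothHypersurface.hypersurfaceι (fermatPolynomial ℂ (2 * (0 + s + 1)) m))
              (AlgPoints.map φ P)).rep (embFirst 0 s 1) =
            ε * (hypersurfacePoint (SmoothHypersurface.hypersurfaceι (fermatPolynomial ℂ (2 * (0 + s + 1)) m))
              (AlgPoints.map φ P)).rep (embFirst 0 s 0)) ∧
        complexGysin complexOrientationFamily hE
          (isSmoothProjective_fermatHypersurface (n := 2 * (0 + s + 1)) (by omega) NeZero.one_le) φ
          (show 0 + 2 * (2 * (0 + s + 1)) = 2 + 2 * (2 * s + 1) by omega)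
          (singularCohomology.one ℂ (ComplexPoints E)) ≠ 0) :
    Shioda1979_coneSpan_represents_left := by
  intro m s _ α β hs hα hβ
  obtain ⟨E, hE, π, hπ, σ, hσπ, hσ, φ, hσφ, ε, hε, hcone, h1⟩ := hdata m s hs
  haveI := hπ
  haveI := hσ
  have hX : IsSmoothProjective (2 * (0 + s + 1)) (fermatHypersurface (2 * (0 + s + 1)) m) :=
    isSmoothProjective_fermatHypersurface (by omega) NeZero.one_le
  obtain ⟨w, hw, hne⟩ := coneSpan_represents_of_coneCoordinates hs hE hX π σ hσπ φ hσφ hε hcone h1 hα hβ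
  exact ⟨complexOrientationFamily, 2 * s + 1, E, hE, hX, π, hπ, φ, rfl, w, hw, hne⟩

end Literature.AlgebraicGeometry.HodgeTheory

end
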